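import Summits.CriticalPhenomena.PercolationContinuityZ3.Theorems.PercNearOneGluingNoHeavyLowerTailSahiCombFourChainRank

/-!
# The four-chain rank lemma II: restriction to an up-set and the counting corollary (AN♯1)

Support file of the one-cut programme (crux `NoHeavyLowerTail`, stmt-CriticalPhenomena-4575; cell `prim-masterthm`, seat P5 gen 16;
report `P5-LORENTZIAN-TEST.md` §20).  Companion of `…SahiCombFourChainRank` (`fourChain_kernel_eq_zero`, the kernel form at `P = ⊤`).

* **`FiveUpSet.fourChain_kernel_eq_zero_of_upperSet`** — the kernel form inside an arbitrary up-set `P` (the restriction to `P` is free: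
  a demand `s ∈ P` only sees supplies `t ⊇ s`, which lie in `P`).
* `FiveUpSet.sum_coe_zeta_eq_sum_ext` — bookkeeping (subtype sums against zero-extended coefficient vectors).
* **`FiveUpSet.fourChainIneq_holds`** — THE FOUR-CHAIN INEQUALITY (AN♯1): for chains of up-sets `Φ₀ ⊆ Φ₁ ⊆ Φ₂ ⊆ Φ₃`, `Γ₀ ⊆ Γ₁ ⊆ Γ₂ ⊆ Γ₃`
  and an up-set `P` of a finite cube, with `Σ' = ((Φ₃ \ Φ₀) ∩ (Γ₃ \ Γ₀)) \ ((Φ₂ \ Φ₁) ∩ (Γ₂ \ Γ₁))`,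
  `#(P ∩ refl Σ') + #(P ∩ Φ₃ ∩ refl Γ₀) + #(P ∩ Γ₃ ∩ refl Φ₀) + #(P ∩ Φ₃ ∩ refl Γ₂) + #(P ∩ Γ₃ ∩ refl Φ₂)`
  `≤ #(P ∩ (Φ₃ ∩ Γ₃)) + #(P ∩ (Φ₂ ∩ Γ₃ ∪ Φ₃ ∩ Γ₂)) + #(P ∩ (Φ₁ ∩ Γ₂ ∪ Φ₂ ∩ Γ₁)) + #(P ∩ (Φ₀ ∩ Γ₀))`,
  i.e. `#(P ∩ refl Σ') ≤ #(P ∩ Σ') + Kl_P(Φ₃;Γ₀) + Kl_P(Γ₃;Φ₀) + Kl_P(Φ₃;Γ₂) + Kl_P(Γ₃;Φ₂)` — the anti-nested (`a = 2`) analogue of the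
  five-up-set inequality `#(P ∩ refl Sh) ≤ #(P ∩ Sh) + Kl_P(Φ₁;Γ₀) + Kl_P(Γ₁;Φ₀)` (census: exhaustive `n = 2`, 2.5e7 sampled tests `n ≤ 5`, 0 violations,
  many equalities).
HONEST LABEL: complete proofs, std axioms.  The bridge from (AN♯1)-type rank lemmas to the anti-nested stratum of `TriWIneq` is NOT in this file. [this work]
-/

namespace Summit.CriticalPhenomena.PercolationContinuityZ3.Theorems

namespace FiveUpSet

open Finset

variable {α : Type*} [DecidableEq α] [Fintype α]

/-- **The four-chain rank lemma, kernel form inside an up-set `P`** (the restriction to `P` is free): as `fourChain_kernel_eq_zero`, with the five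
coefficient vectors supported inside `P` and the four equations required only at `t ∈ P` — at `t ∉ P` every term `[s ⊆ t]` with `s ∈ P`
vanishes because `P` is an up-set. [this work] -/
theorem fourChain_kernel_eq_zero_of_upperSet (P Φ₀ Φ₁ Φ₂ Φ₃ Γ₀ Γ₁ Γ₂ Γ₃ : Finset (Finset α)) (hP : IsUpperSet (P : Set (Finset α)))
    (hΦ₀ : IsUpperSet (Φ₀ : Set (Finset α))) (hΦ₁ : IsUpperSet (Φ₁ : Set (Finset α)))
    (hΦ₂ : IsUpperSet (Φ₂ : Set (Finset α))) (hΦ₃ : IsUpperSet (Φ₃ : Set (Finset α)))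
    (hΓ₀ : IsUpperSet (Γ₀ : Set (Finset α))) (hΓ₁ : IsUpperSet (Γ₁ : Set (Finset α)))
    (hΓ₂ : IsUpperSet (Γ₂ : Set (Finset α))) (hΓ₃ : IsUpperSet (Γ₃ : Set (Finset α)))
    (hΦ₀₁ : Φ₀ ⊆ Φ₁) (hΦ₁₂ : Φ₁ ⊆ Φ₂) (hΦ₂₃ : Φ₂ ⊆ Φ₃) (hΓ₀₁ : Γ₀ ⊆ Γ₁) (hΓ₁₂ : Γ₁ ⊆ Γ₂) (hΓ₂₃ : Γ₂ ⊆ Γ₃)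
    (ka kb kc kd ke : Finset α → ℚ)
    (hka : ∀ s, ka s ≠ 0 → s ∈ P ∧ sᶜ ∈ Φ₃ ∧ sᶜ ∉ Φ₀ ∧ sᶜ ∈ Γ₃ ∧ sᶜ ∉ Γ₀ ∧ ¬ (sᶜ ∈ Φ₂ ∧ sᶜ ∉ Φ₁ ∧ sᶜ ∈ Γ₂ ∧ sᶜ ∉ Γ₁))
    (hkb : ∀ s, kb s ≠ 0 → s ∈ P ∧ s ∈ Φ₃ ∧ sᶜ ∈ Γ₀)
    (hkc : ∀ s, kc s ≠ 0 → s ∈ P ∧ s ∈ Γ₃ ∧ sᶜ ∈ Φ₀)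
    (hkd : ∀ s, kd s ≠ 0 → s ∈ P ∧ s ∈ Φ₃ ∧ sᶜ ∈ Γ₂)
    (hke : ∀ s, ke s ≠ 0 → s ∈ P ∧ s ∈ Γ₃ ∧ sᶜ ∈ Φ₂)
    (h1 : ∀ t, t ∈ P → t ∈ Φ₃ → t ∈ Γ₃ →
      ∑ s, ka s * (if s ⊆ t then (1 : ℚ) else 0) + ∑ s, kb s * (if s ⊆ t then (1 : ℚ) else 0)
        + ∑ s, kc s * (if s ⊆ t then (1 : ℚ) else 0) + ∑ s, ke s * (if s ⊆ t then (1 : ℚ) else 0) = 0)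
    (h2 : ∀ t, t ∈ P → (t ∈ Φ₂ ∧ t ∈ Γ₃) ∨ (t ∈ Φ₃ ∧ t ∈ Γ₂) →
      ∑ s, kd s * (if s ⊆ t then (1 : ℚ) else 0) + ∑ s, ke s * (if s ⊆ t then (1 : ℚ) else 0) = 0)
    (h3 : ∀ t, t ∈ P → (t ∈ Φ₁ ∧ t ∈ Γ₂) ∨ (t ∈ Φ₂ ∧ t ∈ Γ₁) → ∑ s, kd s * (if s ⊆ t then (1 : ℚ) else 0) = 0)
    (h4 : ∀ t, t ∈ P → t ∈ Φ₀ → t ∈ Γ₀ → ∑ s, kc s * (if s ⊆ t then (1 : ℚ) else 0) = 0) :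
    (∀ s, ka s = 0) ∧ (∀ s, kb s = 0) ∧ (∀ s, kc s = 0) ∧ (∀ s, kd s = 0) ∧ (∀ s, ke s = 0) := by
  have vanish : ∀ (x : Finset α → ℚ), (∀ s, x s ≠ 0 → s ∈ P) → ∀ t, t ∉ P →
      ∑ s, x s * (if s ⊆ t then (1 : ℚ) else 0) = 0 := by
    intro x hx t ht
    refine Finset.sum_eq_zero fun s _ => ?_
    by_cases hs : x s = 0
    · rw [hs, zero_mul]
    · have hst : ¬ s ⊆ t := fun h => ht (hP h (hx s hs))
      rw [if_neg hst, mul_zero]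
  have hkaP : ∀ s, ka s ≠ 0 → s ∈ P := fun s hs => (hka s hs).1
  have hkbP : ∀ s, kb s ≠ 0 → s ∈ P := fun s hs => (hkb s hs).1
  have hkcP : ∀ s, kc s ≠ 0 → s ∈ P := fun s hs => (hkc s hs).1
  have hkdP : ∀ s, kd s ≠ 0 → s ∈ P := fun s hs => (hkd s hs).1
  have hkeP : ∀ s, ke s ≠ 0 → s ∈ P := fun s hs => (hke s hs).1
  refine fourChain_kernel_eq_zero Φ₀ Φ₁ Φ₂ Φ₃ Γ₀ Γ₁ Γ₂ Γ₃ hΦ₀ hΦ₁ hΦ₂ hΦ₃ hΓ₀ hΓ₁ hΓ₂ hΓ₃ hΦ₀₁ hΦ₁₂ hΦ₂₃ hΓ₀₁ hΓ₁₂ hΓ₂₃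
    ka kb kc kd ke (fun s hs => (hka s hs).2) (fun s hs => (hkb s hs).2) (fun s hs => (hkc s hs).2)
    (fun s hs => (hkd s hs).2) (fun s hs => (hke s hs).2) ?_ ?_ ?_ ?_
  · intro t htΦ htΓ
    by_cases htP : t ∈ P
    · exact h1 t htP htΦ htΓ
    · rw [vanish ka hkaP t htP, vanish kb hkbP t htP, vanish kc hkcP t htP, vanish ke hkeP t htP]; ring
  · intro t ht
    by_cases htP : t ∈ P
    · exact h2 t htP ht
    · rw [vanish kd hkdP t htP, vanish ke hkeP t htP]; ring
  · intro t ht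
    by_cases htP : t ∈ P
    · exact h3 t htP ht
    · exact vanish kd hkdP t htP
  · intro t htΦ htΓ
    by_cases htP : t ∈ P
    · exact h4 t htP htΦ htΓ
    · exact vanish kc hkcP t htP

/-! ### The counting corollary (AN♯1) -/

/-- Sums over the subtype of a finset against sums over the cube of the zero-extended coefficient vector. [this work] -/
theorem sum_coe_zeta_eq_sum_ext (S : Finset (Finset α)) (g' : ↥S → ℚ) (x : Finset α → ℚ)
    (hx : ∀ s, x s = if h : s ∈ S then g' ⟨s, h⟩ else 0) (t : Finset α) :
    ∑ s : ↥S, g' s * (if (s : Finset α) ⊆ t then (1 : ℚ) else 0) = ∑ s, x s * (if s ⊆ t then (1 : ℚ) else 0) := by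
  have h1 : ∑ s, x s * (if s ⊆ t then (1 : ℚ) else 0) = ∑ s ∈ S, x s * (if s ⊆ t then (1 : ℚ) else 0) := by
    refine (Finset.sum_subset (subset_univ _) ?_).symm
    intro s _ hs
    rw [hx s, dif_neg hs, zero_mul]
  rw [h1]
  conv_rhs => rw [← Finset.sum_coe_sort]
  refine Finset.sum_congr rfl fun s _ => ?_
  rw [hx s, dif_pos s.2]

/-- **THE FOUR-CHAIN INEQUALITY (AN♯1).**  For chains of up-sets `Φ₀ ⊆ Φ₁ ⊆ Φ₂ ⊆ Φ₃`, `Γ₀ ⊆ Γ₁ ⊆ Γ₂ ⊆ Γ₃` and an up-set `P` of a finite cube,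
with `Σ' = ((Φ₃ \ Φ₀) ∩ (Γ₃ \ Γ₀)) \ ((Φ₂ \ Φ₁) ∩ (Γ₂ \ Γ₁))` (eight of the nine layer blocks),
`#(P ∩ refl Σ') + #(P ∩ Φ₃ ∩ refl Γ₀) + #(P ∩ Γ₃ ∩ refl Φ₀) + #(P ∩ Φ₃ ∩ refl Γ₂) + #(P ∩ Γ₃ ∩ refl Φ₂)`
`≤ #(P ∩ (Φ₃ ∩ Γ₃)) + #(P ∩ (Φ₂ ∩ Γ₃ ∪ Φ₃ ∩ Γ₂)) + #(P ∩ (Φ₁ ∩ Γ₂ ∪ Φ₂ ∩ Γ₁)) + #(P ∩ (Φ₀ ∩ Γ₀))`;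
equivalently `#(P ∩ refl Σ') ≤ #(P ∩ Σ') + Kl_P(Φ₃;Γ₀) + Kl_P(Γ₃;Φ₀) + Kl_P(Φ₃;Γ₂) + Kl_P(Γ₃;Φ₂)` with `Kl_P(A;B) = #(P ∩ A ∩ B) − #(P ∩ A ∩ refl B)`
(the a = 1 analogue is the five-up-set inequality `#(P ∩ refl Sh) ≤ #(P ∩ Sh) + Kl_P(Φ₁;Γ₀) + Kl_P(Γ₁;Φ₀)`).  PROOF: the demand vectors (rows of
the levelled inclusion matrix) are linearly independent in `ℚ^{supplies}` by `fourChain_kernel_eq_zero_of_upperSet`, so their number is at most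
the dimension. [this work] -/
theorem fourChainIneq_holds (P Φ₀ Φ₁ Φ₂ Φ₃ Γ₀ Γ₁ Γ₂ Γ₃ : Finset (Finset α)) (hP : IsUpperSet (P : Set (Finset α)))
    (hΦ₀ : IsUpperSet (Φ₀ : Set (Finset α))) (hΦ₁ : IsUpperSet (Φ₁ : Set (Finset α)))
    (hΦ₂ : IsUpperSet (Φ₂ : Set (Finset α))) (hΦ₃ : IsUpperSet (Φ₃ : Set (Finset α)))
    (hΓ₀ : IsUpperSet (Γ₀ : Set (Finset α))) (hΓ₁ : IsUpperSet (Γ₁ : Set (Finset α)))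
    (hΓ₂ : IsUpperSet (Γ₂ : Set (Finset α))) (hΓ₃ : IsUpperSet (Γ₃ : Set (Finset α)))
    (hΦ₀₁ : Φ₀ ⊆ Φ₁) (hΦ₁₂ : Φ₁ ⊆ Φ₂) (hΦ₂₃ : Φ₂ ⊆ Φ₃) (hΓ₀₁ : Γ₀ ⊆ Γ₁) (hΓ₁₂ : Γ₁ ⊆ Γ₂) (hΓ₂₃ : Γ₂ ⊆ Γ₃) :
    (P ∩ refl (((Φ₃ \ Φ₀) ∩ (Γ₃ \ Γ₀)) \ ((Φ₂ \ Φ₁) ∩ (Γ₂ \ Γ₁)))).card + (P ∩ Φ₃ ∩ refl Γ₀).card + (P ∩ Γ₃ ∩ refl Φ₀).card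
        + (P ∩ Φ₃ ∩ refl Γ₂).card + (P ∩ Γ₃ ∩ refl Φ₂).card
      ≤ (P ∩ (Φ₃ ∩ Γ₃)).card + (P ∩ (Φ₂ ∩ Γ₃ ∪ Φ₃ ∩ Γ₂)).card + (P ∩ (Φ₁ ∩ Γ₂ ∪ Φ₂ ∩ Γ₁)).card + (P ∩ (Φ₀ ∩ Γ₀)).card := by
  set Sig : Finset (Finset α) := ((Φ₃ \ Φ₀) ∩ (Γ₃ \ Γ₀)) \ ((Φ₂ \ Φ₁) ∩ (Γ₂ \ Γ₁)) with hSig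
  -- the zeta entry and the row vectors of the five classes on the four supply blocks
  have hli : LinearIndependent ℚ
      (Sum.elim
        (fun s : ↥(P ∩ refl Sig) =>
          Sum.elim (fun t : ↥(P ∩ (Φ₃ ∩ Γ₃)) => if (s : Finset α) ⊆ (t : Finset α) then (1 : ℚ) else 0)
            (Sum.elim (fun _ : ↥(P ∩ (Φ₂ ∩ Γ₃ ∪ Φ₃ ∩ Γ₂)) => (0 : ℚ))
              (Sum.elim (fun _ : ↥(P ∩ (Φ₁ ∩ Γ₂ ∪ Φ₂ ∩ Γ₁)) => (0 : ℚ)) (fun _ : ↥(P ∩ (Φ₀ ∩ Γ₀)) => (0 : ℚ)))))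
        (Sum.elim
          (fun s : ↥(P ∩ Φ₃ ∩ refl Γ₀) =>
            Sum.elim (fun t : ↥(P ∩ (Φ₃ ∩ Γ₃)) => if (s : Finset α) ⊆ (t : Finset α) then (1 : ℚ) else 0)
              (Sum.elim (fun _ : ↥(P ∩ (Φ₂ ∩ Γ₃ ∪ Φ₃ ∩ Γ₂)) => (0 : ℚ))
                (Sum.elim (fun _ : ↥(P ∩ (Φ₁ ∩ Γ₂ ∪ Φ₂ ∩ Γ₁)) => (0 : ℚ)) (fun _ : ↥(P ∩ (Φ₀ ∩ Γ₀)) => (0 : ℚ)))))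
          (Sum.elim
            (fun s : ↥(P ∩ Γ₃ ∩ refl Φ₀) =>
              Sum.elim (fun t : ↥(P ∩ (Φ₃ ∩ Γ₃)) => if (s : Finset α) ⊆ (t : Finset α) then (1 : ℚ) else 0)
                (Sum.elim (fun _ : ↥(P ∩ (Φ₂ ∩ Γ₃ ∪ Φ₃ ∩ Γ₂)) => (0 : ℚ))
                  (Sum.elim (fun _ : ↥(P ∩ (Φ₁ ∩ Γ₂ ∪ Φ₂ ∩ Γ₁)) => (0 : ℚ))
                    (fun t : ↥(P ∩ (Φ₀ ∩ Γ₀)) => if (s : Finset α) ⊆ (t : Finset α) then (1 : ℚ) else 0))))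
            (Sum.elim
              (fun s : ↥(P ∩ Φ₃ ∩ refl Γ₂) =>
                Sum.elim (fun _ : ↥(P ∩ (Φ₃ ∩ Γ₃)) => (0 : ℚ))
                  (Sum.elim (fun t : ↥(P ∩ (Φ₂ ∩ Γ₃ ∪ Φ₃ ∩ Γ₂)) => if (s : Finset α) ⊆ (t : Finset α) then (1 : ℚ) else 0)
                    (Sum.elim (fun t : ↥(P ∩ (Φ₁ ∩ Γ₂ ∪ Φ₂ ∩ Γ₁)) => if (s : Finset α) ⊆ (t : Finset α) then (1 : ℚ) else 0)
                      (fun _ : ↥(P ∩ (Φ₀ ∩ Γ₀)) => (0 : ℚ)))))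
              (fun s : ↥(P ∩ Γ₃ ∩ refl Φ₂) =>
                Sum.elim (fun t : ↥(P ∩ (Φ₃ ∩ Γ₃)) => if (s : Finset α) ⊆ (t : Finset α) then (1 : ℚ) else 0)
                  (Sum.elim (fun t : ↥(P ∩ (Φ₂ ∩ Γ₃ ∪ Φ₃ ∩ Γ₂)) => if (s : Finset α) ⊆ (t : Finset α) then (1 : ℚ) else 0)
                    (Sum.elim (fun _ : ↥(P ∩ (Φ₁ ∩ Γ₂ ∪ Φ₂ ∩ Γ₁)) => (0 : ℚ)) (fun _ : ↥(P ∩ (Φ₀ ∩ Γ₀)) => (0 : ℚ)))))))))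
      := by
    rw [Fintype.linearIndependent_iff]
    intro g hg
    -- the five coefficient vectors on the cube
    obtain ⟨ka, hka⟩ : ∃ f : Finset α → ℚ, ∀ s, f s = if h : s ∈ P ∩ refl Sig then g (Sum.inl ⟨s, h⟩) else 0 := ⟨_, fun _ => rfl⟩
    obtain ⟨kb, hkb⟩ : ∃ f : Finset α → ℚ, ∀ s, f s = if h : s ∈ P ∩ Φ₃ ∩ refl Γ₀ then g (Sum.inr (Sum.inl ⟨s, h⟩)) else 0 :=
      ⟨_, fun _ => rfl⟩
    obtain ⟨kc, hkc⟩ : ∃ f : Finset α → ℚ, ∀ s,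
        f s = if h : s ∈ P ∩ Γ₃ ∩ refl Φ₀ then g (Sum.inr (Sum.inr (Sum.inl ⟨s, h⟩))) else 0 := ⟨_, fun _ => rfl⟩
    obtain ⟨kd, hkd⟩ : ∃ f : Finset α → ℚ, ∀ s,
        f s = if h : s ∈ P ∩ Φ₃ ∩ refl Γ₂ then g (Sum.inr (Sum.inr (Sum.inr (Sum.inl ⟨s, h⟩)))) else 0 := ⟨_, fun _ => rfl⟩
    obtain ⟨ke, hke⟩ : ∃ f : Finset α → ℚ, ∀ s,
        f s = if h : s ∈ P ∩ Γ₃ ∩ refl Φ₂ then g (Sum.inr (Sum.inr (Sum.inr (Sum.inr ⟨s, h⟩)))) else 0 := ⟨_, fun _ => rfl⟩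
    have hkasupp : ∀ s, ka s ≠ 0 → s ∈ P ∩ refl Sig := by
      intro s hs; by_contra h; rw [hka s, dif_neg h] at hs; exact hs rfl
    have hkbsupp : ∀ s, kb s ≠ 0 → s ∈ P ∩ Φ₃ ∩ refl Γ₀ := by
      intro s hs; by_contra h; rw [hkb s, dif_neg h] at hs; exact hs rfl
    have hkcsupp : ∀ s, kc s ≠ 0 → s ∈ P ∩ Γ₃ ∩ refl Φ₀ := by
      intro s hs; by_contra h; rw [hkc s, dif_neg h] at hs; exact hs rfl
    have hkdsupp : ∀ s, kd s ≠ 0 → s ∈ P ∩ Φ₃ ∩ refl Γ₂ := by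
      intro s hs; by_contra h; rw [hkd s, dif_neg h] at hs; exact hs rfl
    have hkesupp : ∀ s, ke s ≠ 0 → s ∈ P ∩ Γ₃ ∩ refl Φ₂ := by
      intro s hs; by_contra h; rw [hke s, dif_neg h] at hs; exact hs rfl
    -- sums over the index finsets are sums over the cube
    have suma := sum_coe_zeta_eq_sum_ext (P ∩ refl Sig) (fun s => g (Sum.inl s)) ka hka
    have sumb := sum_coe_zeta_eq_sum_ext (P ∩ Φ₃ ∩ refl Γ₀) (fun s => g (Sum.inr (Sum.inl s))) kb hkb
    have sumc := sum_coe_zeta_eq_sum_ext (P ∩ Γ₃ ∩ refl Φ₀) (fun s => g (Sum.inr (Sum.inr (Sum.inl s)))) kc hkc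
    have sumd := sum_coe_zeta_eq_sum_ext (P ∩ Φ₃ ∩ refl Γ₂) (fun s => g (Sum.inr (Sum.inr (Sum.inr (Sum.inl s))))) kd hkd
    have sume := sum_coe_zeta_eq_sum_ext (P ∩ Γ₃ ∩ refl Φ₂) (fun s => g (Sum.inr (Sum.inr (Sum.inr (Sum.inr s))))) ke hke
    -- the four equations
    have E1 : ∀ t, t ∈ P → t ∈ Φ₃ → t ∈ Γ₃ →
        ∑ s, ka s * (if s ⊆ t then (1 : ℚ) else 0) + ∑ s, kb s * (if s ⊆ t then (1 : ℚ) else 0)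
          + ∑ s, kc s * (if s ⊆ t then (1 : ℚ) else 0) + ∑ s, ke s * (if s ⊆ t then (1 : ℚ) else 0) = 0 := by
      intro t htP htΦ htΓ
      have h := congrFun hg (Sum.inl ⟨t, mem_inter.2 ⟨htP, mem_inter.2 ⟨htΦ, htΓ⟩⟩⟩)
      rw [Finset.sum_apply, Fintype.sum_sum_type, Fintype.sum_sum_type, Fintype.sum_sum_type, Fintype.sum_sum_type] at h
      simp only [Pi.smul_apply, smul_eq_mul, Pi.zero_apply, Sum.elim_inl, Sum.elim_inr, mul_zero,
        Finset.sum_const_zero] at h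
      rw [suma t, sumb t, sumc t, sume t] at h
      linarith [h]
    have E2 : ∀ t, t ∈ P → (t ∈ Φ₂ ∧ t ∈ Γ₃) ∨ (t ∈ Φ₃ ∧ t ∈ Γ₂) →
        ∑ s, kd s * (if s ⊆ t then (1 : ℚ) else 0) + ∑ s, ke s * (if s ⊆ t then (1 : ℚ) else 0) = 0 := by
      intro t htP ht
      have htV : t ∈ P ∩ (Φ₂ ∩ Γ₃ ∪ Φ₃ ∩ Γ₂) := by
        refine mem_inter.2 ⟨htP, ?_⟩
        rcases ht with h | h
        · exact mem_union.2 (Or.inl (mem_inter.2 h))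
        · exact mem_union.2 (Or.inr (mem_inter.2 h))
      have h := congrFun hg (Sum.inr (Sum.inl ⟨t, htV⟩))
      rw [Finset.sum_apply, Fintype.sum_sum_type, Fintype.sum_sum_type, Fintype.sum_sum_type, Fintype.sum_sum_type] at h
      simp only [Pi.smul_apply, smul_eq_mul, Pi.zero_apply, Sum.elim_inl, Sum.elim_inr, mul_zero,
        Finset.sum_const_zero] at h
      rw [sumd t, sume t] at h
      linarith [h]
    have E3 : ∀ t, t ∈ P → (t ∈ Φ₁ ∧ t ∈ Γ₂) ∨ (t ∈ Φ₂ ∧ t ∈ Γ₁) → ∑ s, kd s * (if s ⊆ t then (1 : ℚ) else 0) = 0 := by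
      intro t htP ht
      have htV : t ∈ P ∩ (Φ₁ ∩ Γ₂ ∪ Φ₂ ∩ Γ₁) := by
        refine mem_inter.2 ⟨htP, ?_⟩
        rcases ht with h | h
        · exact mem_union.2 (Or.inl (mem_inter.2 h))
        · exact mem_union.2 (Or.inr (mem_inter.2 h))
      have h := congrFun hg (Sum.inr (Sum.inr (Sum.inl ⟨t, htV⟩)))
      rw [Finset.sum_apply, Fintype.sum_sum_type, Fintype.sum_sum_type, Fintype.sum_sum_type, Fintype.sum_sum_type] at h
      simp only [Pi.smul_apply, smul_eq_mul, Pi.zero_apply, Sum.elim_inl, Sum.elim_inr, mul_zero,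
        Finset.sum_const_zero] at h
      rw [sumd t] at h
      linarith [h]
    have E4 : ∀ t, t ∈ P → t ∈ Φ₀ → t ∈ Γ₀ → ∑ s, kc s * (if s ⊆ t then (1 : ℚ) else 0) = 0 := by
      intro t htP htΦ htΓ
      have h := congrFun hg (Sum.inr (Sum.inr (Sum.inr ⟨t, mem_inter.2 ⟨htP, mem_inter.2 ⟨htΦ, htΓ⟩⟩⟩)))
      rw [Finset.sum_apply, Fintype.sum_sum_type, Fintype.sum_sum_type, Fintype.sum_sum_type, Fintype.sum_sum_type] at h
      simp only [Pi.smul_apply, smul_eq_mul, Pi.zero_apply, Sum.elim_inl, Sum.elim_inr, mul_zero,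
        Finset.sum_const_zero] at h
      rw [sumc t] at h
      linarith [h]
    -- the kernel theorem
    have K := fourChain_kernel_eq_zero_of_upperSet P Φ₀ Φ₁ Φ₂ Φ₃ Γ₀ Γ₁ Γ₂ Γ₃ hP hΦ₀ hΦ₁ hΦ₂ hΦ₃ hΓ₀ hΓ₁ hΓ₂ hΓ₃
      hΦ₀₁ hΦ₁₂ hΦ₂₃ hΓ₀₁ hΓ₁₂ hΓ₂₃ ka kb kc kd ke ?_ ?_ ?_ ?_ ?_ E1 E2 E3 E4
    · rintro (⟨s, hs⟩ | ⟨s, hs⟩ | ⟨s, hs⟩ | ⟨s, hs⟩ | ⟨s, hs⟩)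
      · have h := K.1 s
        rwa [hka s, dif_pos hs] at h
      · have h := K.2.1 s
        rwa [hkb s, dif_pos hs] at h
      · have h := K.2.2.1 s
        rwa [hkc s, dif_pos hs] at h
      · have h := K.2.2.2.1 s
        rwa [hkd s, dif_pos hs] at h
      · have h := K.2.2.2.2 s
        rwa [hke s, dif_pos hs] at h
    · intro s hs
      have h := hkasupp s hs
      have h' : sᶜ ∈ Sig := mem_refl.1 (mem_inter.1 h).2
      rw [hSig, mem_sdiff, mem_inter, mem_sdiff, mem_sdiff, mem_inter, mem_sdiff, mem_sdiff] at h'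
      exact ⟨(mem_inter.1 h).1, h'.1.1.1, h'.1.1.2, h'.1.2.1, h'.1.2.2, fun hh => h'.2 ⟨⟨hh.1, hh.2.1⟩, hh.2.2.1, hh.2.2.2⟩⟩
    · intro s hs
      have h := hkbsupp s hs
      exact ⟨(mem_inter.1 (mem_inter.1 h).1).1, (mem_inter.1 (mem_inter.1 h).1).2, mem_refl.1 (mem_inter.1 h).2⟩
    · intro s hs
      have h := hkcsupp s hs
      exact ⟨(mem_inter.1 (mem_inter.1 h).1).1, (mem_inter.1 (mem_inter.1 h).1).2, mem_refl.1 (mem_inter.1 h).2⟩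
    · intro s hs
      have h := hkdsupp s hs
      exact ⟨(mem_inter.1 (mem_inter.1 h).1).1, (mem_inter.1 (mem_inter.1 h).1).2, mem_refl.1 (mem_inter.1 h).2⟩
    · intro s hs
      have h := hkesupp s hs
      exact ⟨(mem_inter.1 (mem_inter.1 h).1).1, (mem_inter.1 (mem_inter.1 h).1).2, mem_refl.1 (mem_inter.1 h).2⟩
  -- count: independent vectors are at most the dimension
  have hcard := hli.fintype_card_le_finrank
  rw [Module.finrank_fintype_fun_eq_card] at hcard
  simp only [Fintype.card_sum, Fintype.card_coe] at hcard
  omega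

end FiveUpSet

end Summit.CriticalPhenomena.PercolationContinuityZ3.Theorems
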